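import Summits.Ventures.CertifiedManyBodySolver.Downfold.PhaseMapTablePooling

/-!
# Supplementary truth cells: what «admitted, labelled, excluded from the headline» means for a §7 tally

Venture CertifiedManyBodySolver, cell `pub/hubbard-downfold`, seat hubbard-downfold-score-1 (second scoring engine);
namespace `Summit.Ventures.CertifiedManyBodySolver.Downfold.CellScore`. Context: ACCEPTANCE §2.3 (`sc-truth/1.0` truth
columns, one per (P, H)), §4 tallies, §8 P1 (blindness: truth written before the producer's word), and the downfold-lead's
VALIDATION-SET ruling R14 (2026-08-27T02:21Z) on the first INTERPOLATED, POST-EXPOSURE truth column (#68 LuH₂ @ 1 GPa,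
«noSC-down-to 1.5 K», written after the router word at that pressure was public): «ADMITTED AS A LABELLED SUPPLEMENTARY
CELL, not a headline cell … the headline count uses measured columns only … the same rule will apply to any later
interpolated or post-exposure truth cell in either direction». Since 01:39Z the curators also write INTERPOLATED /
EXTRAPOLATED columns in the v1 table (#1 Al @ 5 GPa «SC 0.25 ± 0.20 K interpolated», @ 10 GPa «not ≥ 0.08 K extrapolated»).
Second-engine finding F20 (02:35Z): `sc-truth/1.0` has NO machine key for a column's provenance class, so both scoring
engines count such columns exactly like measured ones. Everything below is PROVED (ℕ/ℚ arithmetic over `Tally`).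

WHAT THIS IS NOT: not a scoring rule (the acceptance pen decides between reading (a) «R14 binds the router-word table only»,
(b) «typed per-column key, supplementary cells tallied apart and excluded from the headline clauses», (c) «key, label only»)
and not a number about any material. It is the KERNEL REFERENCE for what each reading does to a §7 floor clause:

* §1 `ColBasis` (measured ∣ interpolated ∣ extrapolated), `TruthCol` = a truth column with its provenance class, its
  post-exposure flag and the `Tally` it contributes to ONE §4 ratio of ONE table; `headline c` ⇔ measured ∧ ¬post-exposure
  (R14's words); `headlineTally` (reading (b)), `allTally` (readings (a)/(c)), `suppTally` (the labelled supplementary line).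
* §2 THE SPLIT IS A POOLING: `allTally_eq_pool` — counting every column = pooling the headline tally with the supplementary
  one. Hence (§3 of `PhaseMapTablePooling`) `ratio_all_between`: the all-columns ratio is a weighted average of the two and
  carries no information beyond them; and `headline_le_all_num/den`: the headline tally is componentwise below.
* §3 READING (b) IS EXACTLY R14: `headlineTally_append_of_forall_supp` — appending ANY list of supplementary columns
  (interpolated, extrapolated, or post-exposure, in either direction) leaves the headline tally, hence every headline floor
  clause (`headline_meets_append_of_forall_supp`), byte-identical. This is also the mechanical form of §8 P1: a truth cell
  written after exposure cannot move a headline number. `headlineTally_eq_allTally_of_forall_headline`: on a table whose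
  columns are all measured pre-exposure (every column of record before 01:39Z 08-27) readings (a) and (b) print the same.
* §4 READING (a) IS NOT GAIN-FREE IN THE CELL TABLES (contrast R14's symmetry note, which is true for the router-word table
  where an extra truth cell can only add a miss): `floor_gain_from_supplementary` — a headline tally 0/1 that FAILS a floor
  pools with a supplementary 1/1 into 1/2 … still failing at 0.9, but `decided_gain_from_interpolated_null`: a material
  UNDECIDED on its four measured columns (0 decided cells) becomes DECIDED (18 TN cells = the T22 points ≥ 1.5 K) the moment
  a «not» word meets an interpolated null column — one more decided member for its class floor from an unmeasured cell;
  `accuracy_loss_from_supplementary` (20/20 meets 0.80; six disagreeing cells against an interpolated figure make 20/26,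
  which fails) and `accuracy_gain_from_supplementary` (15/20 fails 0.80; ten agreeing supplementary cells make 25/30, which
  meets it). So under (a) a post-exposure or interpolated truth edit can move a headline clause BOTH ways; only (b) makes
  «excluded from the headline» true in the tables the §7 line is read from.
-/

namespace Summit.Ventures.CertifiedManyBodySolver.Downfold

namespace CellScore

open Tally

/-! ## §1 Truth columns with a provenance class -/

/-- Provenance class of one truth column (F20): a printed datum AT that pressure (`measured`), a value placed BETWEEN
printed data (`interpolated`), or BEYOND them (`extrapolated`). [folklore] -/
inductive ColBasis
  | measured
  | interpolated
  | extrapolated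
  deriving DecidableEq, Repr

/-- One truth column of one material as it enters ONE §4 ratio of ONE table: its provenance class, whether it was written
after the producer's word for that (material, P) was public (§8 P1 «post-exposure»), and the tally (num, den) its cells
contribute (e.g. agreeing decided cells / decided cells; credited / banded; decided-member indicator). [folklore] -/
structure TruthCol where
  /-- provenance class of the column -/
  basis : ColBasis
  /-- written after exposure of the scored word at this (material, P) -/
  postExposure : Bool
  /-- what the column's cells contribute to the tally under discussion -/
  tally : Tally
  deriving DecidableEq, Repr

namespace TruthCol

/-- R14's headline predicate: a column counts in the headline iff it is MEASURED and PRE-EXPOSURE. [folklore] -/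
def headline (c : TruthCol) : Bool := decide (c.basis = .measured) && !c.postExposure

/-- Reading (b): the headline tally pools the headline columns only. [folklore] -/
def headlineTally : List TruthCol → Tally
  | [] => zero
  | c :: cs => if c.headline = true then pool c.tally (headlineTally cs) else headlineTally cs

/-- Readings (a)/(c): every typed column counts (what both engines do under `sc-truth/1.0`, which has no provenance key). [folklore] -/
def allTally : List TruthCol → Tally
  | [] => zero
  | c :: cs => pool c.tally (allTally cs)

/-- The labelled SUPPLEMENTARY line of reading (b): the non-headline columns pooled. [folklore] -/
def suppTally : List TruthCol → Tally
  | [] => zero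
  | c :: cs => if c.headline = true then suppTally cs else pool c.tally (suppTally cs)

/-- A measured pre-exposure column is a headline column (every truth column of record before 2026-08-27T01:39Z). [folklore] -/
theorem headline_of_measured (t : Tally) : headline ⟨.measured, false, t⟩ = true := by simp [headline]

/-- An interpolated column is never a headline column, whatever its exposure flag. [folklore] -/
theorem headline_interpolated (b : Bool) (t : Tally) : headline ⟨.interpolated, b, t⟩ = false := by simp [headline]

/-- An extrapolated column is never a headline column. [folklore] -/
theorem headline_extrapolated (b : Bool) (t : Tally) : headline ⟨.extrapolated, b, t⟩ = false := by simp [headline]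

/-- A post-exposure column is never a headline column, even if measured (§8 P1). [folklore] -/
theorem headline_postExposure (k : ColBasis) (t : Tally) : headline ⟨k, true, t⟩ = false := by simp [headline]

/-! ## §2 Counting every column = pooling headline with supplementary -/

/-- The split is a pooling: all columns = headline columns pooled with supplementary columns. [folklore] -/
theorem allTally_eq_pool (cs : List TruthCol) : allTally cs = pool (headlineTally cs) (suppTally cs) := by
  induction cs with
  | nil => rfl
  | cons c cs ih =>
    cases h : c.headline
    · simp only [allTally, headlineTally, suppTally, h, Bool.false_eq_true, if_false, ih]
      rw [← pool_assoc, pool_comm c.tally (headlineTally cs), pool_assoc]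
    · simp only [allTally, headlineTally, suppTally, h, if_true, ih, pool_assoc]

/-- The headline numerator never exceeds the all-columns numerator. [folklore] -/
theorem headline_num_le_all (cs : List TruthCol) : (headlineTally cs).num ≤ (allTally cs).num := by
  rw [allTally_eq_pool]; exact Nat.le_add_right _ _

/-- The headline denominator never exceeds the all-columns denominator. [folklore] -/
theorem headline_den_le_all (cs : List TruthCol) : (headlineTally cs).den ≤ (allTally cs).den := by
  rw [allTally_eq_pool]; exact Nat.le_add_right _ _

/-- The all-columns ratio is a weighted average of the headline and the supplementary ratios (both applicable): it is
never new information beyond the two labelled lines (mediant bounds of `PhaseMapTablePooling` §3). [folklore] -/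
theorem ratio_all_between (cs : List TruthCol) (hh : 0 < (headlineTally cs).den) (hs : 0 < (suppTally cs).den) :
    min (headlineTally cs).ratio (suppTally cs).ratio ≤ (allTally cs).ratio ∧
      (allTally cs).ratio ≤ max (headlineTally cs).ratio (suppTally cs).ratio := by
  rw [allTally_eq_pool]
  exact ⟨min_ratio_le_ratio_pool _ _ hh hs, ratio_pool_le_max_ratio _ _ hh hs⟩

/-- If both labelled lines meet a floor, the all-columns tally meets it too (the safe direction of pooling). [folklore] -/
theorem all_meets_of_both (θ : ℚ) (cs : List TruthCol) (hh : (headlineTally cs).meets θ = true)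
    (hs : (suppTally cs).meets θ = true) : (allTally cs).meets θ = true := by
  rw [allTally_eq_pool]; exact meets_pool θ _ _ hh hs

/-! ## §3 Reading (b) = R14: supplementary columns cannot move the headline -/

/-- A list made only of supplementary columns has the empty headline tally. [folklore] -/
theorem headlineTally_eq_zero_of_forall_supp (ds : List TruthCol) (h : ∀ c ∈ ds, c.headline = false) :
    headlineTally ds = zero := by
  induction ds with
  | nil => rfl
  | cons d ds ih =>
    have hd : d.headline = false := h d (by simp)
    have ih' := ih (fun c hc => h c (by simp [hc]))
    simp only [headlineTally, hd, Bool.false_eq_true, if_false, ih']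

/-- Headline tallies of concatenated column lists pool. [folklore] -/
theorem headlineTally_append (cs ds : List TruthCol) :
    headlineTally (cs ++ ds) = pool (headlineTally cs) (headlineTally ds) := by
  induction cs with
  | nil => simp only [List.nil_append, headlineTally, zero_pool]
  | cons c cs ih =>
    cases h : c.headline
    · simp only [List.cons_append, headlineTally, h, Bool.false_eq_true, if_false, ih]
    · simp only [List.cons_append, headlineTally, h, if_true, ih, pool_assoc]

/-- THE R14 INVARIANCE (reading (b)): appending any columns that are interpolated, extrapolated or post-exposure — in
either direction, SC or null — leaves the headline tally byte-identical. [folklore] -/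
theorem headlineTally_append_of_forall_supp (cs ds : List TruthCol) (h : ∀ c ∈ ds, c.headline = false) :
    headlineTally (cs ++ ds) = headlineTally cs := by
  rw [headlineTally_append, headlineTally_eq_zero_of_forall_supp ds h, pool_zero]

/-- Hence every headline floor clause (any θ) reads the same before and after such an edit — the mechanical form of
§8 P1 «a truth cell written after the word was public cannot move the headline». [folklore] -/
theorem headline_meets_append_of_forall_supp (θ : ℚ) (cs ds : List TruthCol) (h : ∀ c ∈ ds, c.headline = false) :
    (headlineTally (cs ++ ds)).meets θ = (headlineTally cs).meets θ := by
  rw [headlineTally_append_of_forall_supp cs ds h]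

/-- On a table whose every column is measured pre-exposure, readings (a) and (b) print the same tally: adopting (b)
changes nothing on the columns of record before the first interpolated column was written. [folklore] -/
theorem headlineTally_eq_allTally_of_forall_headline (cs : List TruthCol) (h : ∀ c ∈ cs, c.headline = true) :
    headlineTally cs = allTally cs := by
  induction cs with
  | nil => rfl
  | cons c cs ih =>
    have hc : c.headline = true := h c (by simp)
    have ih' := ih (fun d hd => h d (by simp [hd]))
    simp only [headlineTally, allTally, hc, if_true, ih']

/-- Under reading (a) the same supplementary edit DOES move the printed tally: it becomes the pooled one. [folklore] -/
theorem allTally_append (cs ds : List TruthCol) : allTally (cs ++ ds) = pool (allTally cs) (allTally ds) := by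
  induction cs with
  | nil => simp only [List.nil_append, allTally, zero_pool]
  | cons c cs ih => simp only [List.cons_append, allTally, ih, pool_assoc]

/-! ## §4 Reading (a) is not gain-free in the cell tables: worked shapes -/

/-- #68 LuH₂ shape under reading (a), decided-member indicator per column (num = den = 1 iff the column carries ≥ 1 decided
cell with known truth): four MEASURED null columns (@0, 0.7, 3.7, 7.7 GPa) on which the word is «undetermined» (0/0 each)
and ONE interpolated post-exposure null column (@1 GPa) on which a «not» word would be decided (1/1). [folklore] -/
def luH2Shape : List TruthCol :=
  [⟨.measured, false, ⟨0, 0⟩⟩, ⟨.measured, false, ⟨0, 0⟩⟩, ⟨.measured, false, ⟨0, 0⟩⟩, ⟨.measured, false, ⟨0, 0⟩⟩,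
   ⟨.interpolated, true, ⟨1, 1⟩⟩]

/-- Headline (reading (b)): the material stays UNDECIDED — no measured column carries a decided cell. [folklore] -/
theorem luH2_headline_undecided : (headlineTally luH2Shape).applicable = false := by decide

/-- Reading (a): the material becomes DECIDED from the unmeasured cell alone — one more decided member for the hydride
class floor (decided-fraction ≥ 0.90), i.e. a GAIN for the scored side from a post-exposure truth edit. [folklore] -/
theorem decided_gain_from_interpolated_null : (allTally luH2Shape).applicable = true := by decide

/-- The same column at cell level: 18 = the T22 grid points ≥ the 1.5 K floor of the interpolated null (2, 4, 6, 10, 15,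
20, 30, 40, 50, 70, 100, 130, 160, 200, 250, 300, 350, 400 K); a «not» word there yields 18 agreeing decided cells (TN) on a
pressure at which nothing was measured, and they enter accuracy(screening-grade) under reading (a). [folklore] -/
theorem luH2_cells_reading_a :
    allTally [⟨.measured, false, ⟨0, 0⟩⟩, ⟨.interpolated, true, ⟨18, 18⟩⟩] = ⟨18, 18⟩ ∧
      headlineTally [⟨.measured, false, ⟨0, 0⟩⟩, ⟨.interpolated, true, ⟨18, 18⟩⟩] = zero := by
  constructor <;> decide

/-- A floor can be PASSED by supplementary members alone: a headline tally 9/10 FAILS θ = 19/20, and ten further successes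
counted only on interpolated columns make 19/20 under reading (a), which MEETS it — the decided-fraction analogue of
`PhaseMapTablePooling.pool_hides_failing_table`. [folklore] -/
theorem floor_gain_from_supplementary :
    (headlineTally [⟨.measured, false, ⟨9, 10⟩⟩, ⟨.interpolated, false, ⟨10, 10⟩⟩]).meets (19 / 20) = false ∧
      (allTally [⟨.measured, false, ⟨9, 10⟩⟩, ⟨.interpolated, false, ⟨10, 10⟩⟩]).meets (19 / 20) = true := by
  have h1 : headlineTally [⟨.measured, false, ⟨9, 10⟩⟩, ⟨.interpolated, false, ⟨10, 10⟩⟩] = ⟨9, 10⟩ := by decide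
  have h2 : allTally [⟨.measured, false, ⟨9, 10⟩⟩, ⟨.interpolated, false, ⟨10, 10⟩⟩] = ⟨19, 20⟩ := by decide
  rw [h1, h2, meets_eq_false_iff, meets_eq_true_iff]
  constructor <;> norm_num

/-- #1 Al @ 5 GPa shape: accuracy(screening-grade) 20/20 on the measured columns MEETS 0.80; six cells disagreeing with the
INTERPOLATED figure «SC 0.25 ± 0.20 K» (a band placed above 0.45 K, say) make 20/26 under reading (a), which FAILS 0.80
(0.8·26 = 20.8 > 20) — a LOSS for the scored side from an unmeasured cell. [folklore] -/
theorem accuracy_loss_from_supplementary :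
    (headlineTally [⟨.measured, false, ⟨20, 20⟩⟩, ⟨.interpolated, false, ⟨0, 6⟩⟩]).meets (4 / 5) = true ∧
      (allTally [⟨.measured, false, ⟨20, 20⟩⟩, ⟨.interpolated, false, ⟨0, 6⟩⟩]).meets (4 / 5) = false := by
  have h1 : headlineTally [⟨.measured, false, ⟨20, 20⟩⟩, ⟨.interpolated, false, ⟨0, 6⟩⟩] = ⟨20, 20⟩ := by decide
  have h2 : allTally [⟨.measured, false, ⟨20, 20⟩⟩, ⟨.interpolated, false, ⟨0, 6⟩⟩] = ⟨20, 26⟩ := by decide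
  rw [h1, h2, meets_eq_true_iff, meets_eq_false_iff]
  constructor <;> norm_num

/-- And the converse movement: headline accuracy 15/20 FAILS 0.80; ten agreeing cells on an extrapolated null column make
25/30 under reading (a), which MEETS it (0.8·30 = 24 ≤ 25) — a failing headline clause PASSED by unmeasured cells. [folklore] -/
theorem accuracy_gain_from_supplementary :
    (headlineTally [⟨.measured, false, ⟨15, 20⟩⟩, ⟨.extrapolated, false, ⟨10, 10⟩⟩]).meets (4 / 5) = false ∧
      (allTally [⟨.measured, false, ⟨15, 20⟩⟩, ⟨.extrapolated, false, ⟨10, 10⟩⟩]).meets (4 / 5) = true := by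
  have h1 : headlineTally [⟨.measured, false, ⟨15, 20⟩⟩, ⟨.extrapolated, false, ⟨10, 10⟩⟩] = ⟨15, 20⟩ := by decide
  have h2 : allTally [⟨.measured, false, ⟨15, 20⟩⟩, ⟨.extrapolated, false, ⟨10, 10⟩⟩] = ⟨25, 30⟩ := by decide
  rw [h1, h2, meets_eq_false_iff, meets_eq_true_iff]
  constructor <;> norm_num

/-- Summary of §4 in one statement: there are a floor θ of record and column lists on which the supplementary columns flip
the all-columns clause from FAIL to PASS, and others on which they flip it from PASS to FAIL — while the headline clause is
untouched in both (§3). Reading (a) therefore lets a post-exposure or interpolated truth edit move a §7 clause in EITHER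
direction; reading (b) lets it move none. [folklore] -/
theorem supplementary_moves_all_both_ways :
    (∃ cs ds : List TruthCol, (∀ c ∈ ds, c.headline = false) ∧
        (allTally cs).meets (4 / 5) = false ∧ (allTally (cs ++ ds)).meets (4 / 5) = true) ∧
      (∃ cs ds : List TruthCol, (∀ c ∈ ds, c.headline = false) ∧
        (allTally cs).meets (4 / 5) = true ∧ (allTally (cs ++ ds)).meets (4 / 5) = false) := by
  refine ⟨⟨[⟨.measured, false, ⟨15, 20⟩⟩], [⟨.extrapolated, false, ⟨10, 10⟩⟩], ?_, ?_, ?_⟩,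
          ⟨[⟨.measured, false, ⟨20, 20⟩⟩], [⟨.interpolated, false, ⟨0, 6⟩⟩], ?_, ?_, ?_⟩⟩
  · intro c hc; simp only [List.mem_singleton] at hc; subst hc; decide
  · have e : allTally [⟨.measured, false, ⟨15, 20⟩⟩] = ⟨15, 20⟩ := by decide
    rw [e, meets_eq_false_iff]; norm_num
  · have e : allTally ([⟨.measured, false, ⟨15, 20⟩⟩] ++ [⟨.extrapolated, false, ⟨10, 10⟩⟩]) = ⟨25, 30⟩ := by decide
    rw [e, meets_eq_true_iff]; norm_num
  · intro c hc; simp only [List.mem_singleton] at hc; subst hc; decide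
  · have e : allTally [⟨.measured, false, ⟨20, 20⟩⟩] = ⟨20, 20⟩ := by decide
    rw [e, meets_eq_true_iff]; norm_num
  · have e : allTally ([⟨.measured, false, ⟨20, 20⟩⟩] ++ [⟨.interpolated, false, ⟨0, 6⟩⟩]) = ⟨20, 26⟩ := by decide
    rw [e, meets_eq_false_iff]; norm_num

end TruthCol

/-! ## §5 (appended 2026-08-27 g5, after ACCEPTANCE v1.8 R49 went live) Coverage under typing: why the one headline number that moved went UP

`coverage` = decided truth-known cells / ALL truth-known cells (§4.3). Typing a column supplementary removes its cells from BOTH counts (deputy-2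
02:58Z (c): «truth-known counts are headline-only»). When the typed columns carry NO decided cell (the live case: 11 v1 columns, 161 truth-known
cells, 0 decided) the numerator stays and the denominator shrinks, so coverage can only rise or stay — RUN #10 v1: 57/2140 → 57/1979, printed
0.027 → 0.029. If a typed column DID carry decided agreeing cells, coverage could fall instead (`coverage_can_fall_when_decided_cells_typed`). -/

namespace Tally

/-- Removing `k` truth-known but UNDECIDED cells from the denominator never lowers coverage: a/b ≤ a/(b − k) for k ≤ b − a (so the
denominator stays ≥ the numerator and positive when a > 0). [folklore] -/
theorem coverage_mono_undecided_typed (a b k : ℕ) (ha : 0 < a) (hk : k + a ≤ b) :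
    (Tally.mk a b).ratio ≤ (Tally.mk a (b - k)).ratio := by
  simp only [ratio]
  have hb : (0 : ℚ) < b := by exact_mod_cast (by omega : 0 < b)
  have hbk : (0 : ℚ) < ((b - k : ℕ) : ℚ) := by exact_mod_cast (by omega : 0 < b - k)
  rw [div_le_div_iff₀ hb hbk]
  have : ((b - k : ℕ) : ℚ) ≤ (b : ℚ) := by exact_mod_cast Nat.sub_le b k
  have ha' : (0 : ℚ) ≤ a := by exact_mod_cast ha.le
  nlinarith

/-- RUN #10 v1 numbers of record: 57 decided truth-known cells; 2140 truth-known cells before typing, 161 of them on the 11 typed columns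
(all undecided) ⇒ 57/2140 < 57/1979, i.e. printed coverage 0.027 → 0.029 (both engines). [folklore] -/
theorem run10_coverage_after_typing :
    (Tally.mk 57 2140).ratio < (Tally.mk 57 (2140 - 161)).ratio ∧
      (26 : ℚ) / 1000 < (Tally.mk 57 2140).ratio ∧ (Tally.mk 57 2140).ratio < 27 / 1000 ∧
      (28 : ℚ) / 1000 < (Tally.mk 57 (2140 - 161)).ratio ∧ (Tally.mk 57 (2140 - 161)).ratio < 29 / 1000 := by
  simp only [ratio]; norm_num

/-- … whereas typing a column that carries DECIDED agreeing cells can LOWER coverage: 20 decided of 40 known (0.5); type a column holding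
10 decided + 10 known ⇒ 10/30 < 20/40. (Not today's case — no decided material has a typed column.) [folklore] -/
theorem coverage_can_fall_when_decided_cells_typed :
    (Tally.mk (20 - 10) (40 - 10)).ratio < (Tally.mk 20 40).ratio := by
  simp only [ratio]; norm_num

end Tally

/-! ## §6 (appended 2026-08-27 g6) The hard path reads headline columns only (W11s) and the all-supplementary material

ACCEPTANCE v1.8 §2.3 R49: «a CERTIFIED T_c bound or word in tension with a SUPPLEMENTARY figure prints **W11s** … and never fails the run,
because an interpolated or post-exposure literature figure cannot convict a kernel certificate», and «a material whose EVERY column were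
supplementary would keep kind ABSTAIN and stay in its class's floor denominator». Read each column's tally `num` as the number of H1
incidents its figures raise against the map's certified statements (den = its truth-known cells): the hard count under R49 is the HEADLINE
pooling, W11s counts the rest. Typing can only REMOVE incidents from the hard path (`headline_num_le_all`), so a run that was H-clean on
every column stays H-clean, and the converse fails (one incident on an extrapolated column: hard 0, W11s 1). The all-supplementary material:
its headline tally is `zero` (not applicable ⇒ verdict UNDETERMINED ⇒ kind ABSTAIN by `PhaseMapMaterialVerdict.verdict_of_all_undetermined`),
while the class floor counts MATERIALS, so it contributes (0, 1) — the two-engine what-if of 2026-08-27T04:1xZ (M01 Al with every column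
typed `extrapolated`, a decided SC column on the map: kind ABSTAIN, conventional floor 1/2; untyped: TP, 2/2; 0 discrepancies). -/

namespace TruthCol

/-- W11s never convicts: if no column at all raises an H1 incident, the headline (hard) count is 0 too. [folklore] -/
theorem hard_clean_of_all_clean (cs : List TruthCol) (h : (allTally cs).num = 0) : (headlineTally cs).num = 0 := by
  have := headline_num_le_all cs; omega

/-- … and typing never ADDS a hard incident: the hard count after typing is at most the count with every column headline. [folklore] -/
theorem hard_le_untyped (cs : List TruthCol) : (headlineTally cs).num ≤ (allTally cs).num := headline_num_le_all cs

/-- The converse fails — one incident on an extrapolated column (e.g. a certified ceiling below an EXTRAPOLATED T_c figure): hard path 0,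
W11s 1; under reading (a) the same incident would have been H1. [folklore] -/
theorem w11s_not_hard_example :
    (headlineTally [⟨.measured, false, ⟨0, 22⟩⟩, ⟨.extrapolated, false, ⟨1, 22⟩⟩]).num = 0 ∧
      (suppTally [⟨.measured, false, ⟨0, 22⟩⟩, ⟨.extrapolated, false, ⟨1, 22⟩⟩]).num = 1 ∧
      (allTally [⟨.measured, false, ⟨0, 22⟩⟩, ⟨.extrapolated, false, ⟨1, 22⟩⟩]).num = 1 := by decide

/-- A post-exposure MEASURED column is supplementary as well: its incident is W11s, not H1 (§8 P1). [folklore] -/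
theorem w11s_post_exposure_example :
    (headlineTally [⟨.measured, true, ⟨1, 22⟩⟩]).num = 0 ∧ (suppTally [⟨.measured, true, ⟨1, 22⟩⟩]).num = 1 := by decide

/-- The all-supplementary material: every column typed ⇒ the headline tally is EMPTY (not applicable) whatever the cells say —
the material verdict reads no column, so it is UNDETERMINED / kind ABSTAIN. [folklore] -/
theorem all_supplementary_not_applicable (cs : List TruthCol) (h : ∀ c ∈ cs, c.headline = false) :
    (headlineTally cs).applicable = false := by
  rw [headlineTally_eq_zero_of_forall_supp cs h]; decide

/-- M01-shaped instance of the what-if: four columns (@0 decided 21/21 agreeing, @5/@6.1/@10 undecided), all typed `extrapolated` ⇒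
headline tally zero (ABSTAIN), supplementary tally carries the 21 decided cells (printed, never headline). [folklore] -/
theorem m01_whatif_tallies :
    headlineTally [⟨.extrapolated, false, ⟨21, 21⟩⟩, ⟨.extrapolated, false, ⟨0, 22⟩⟩, ⟨.extrapolated, false, ⟨0, 22⟩⟩, ⟨.extrapolated, false, ⟨0, 22⟩⟩] = zero ∧
      suppTally [⟨.extrapolated, false, ⟨21, 21⟩⟩, ⟨.extrapolated, false, ⟨0, 22⟩⟩, ⟨.extrapolated, false, ⟨0, 22⟩⟩, ⟨.extrapolated, false, ⟨0, 22⟩⟩] = ⟨21, 87⟩ := by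
  decide

end TruthCol

namespace Tally

/-- … yet it STAYS in its class's floor denominator: the decided-fraction floor counts materials, an abstaining material is (0, 1).
What-if numbers: conventional class = {M02 decided, M01 all-supplementary} ⇒ 1/2 fails the 0.9 floor; with M01's columns headline
(decided TP) the class reads 2/2 and meets it. [folklore] -/
theorem all_supplementary_material_in_floor_denominator :
    (pool (Tally.mk 1 1) (Tally.mk 0 1)) = Tally.mk 1 2 ∧ (Tally.mk 1 2).meets (9 / 10) = false ∧ (Tally.mk 2 2).meets (9 / 10) = true := by
  refine ⟨by decide, ?_, ?_⟩ <;> simp only [meets] <;> norm_num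

/-- General form: adding an abstaining material (0, 1) to a class tally never helps a floor θ > 0 that was exactly met or failing —
`k/n` meets θ but `k/(n+1)` need not; precisely, it meets θ iff θ·(n+1) ≤ k. [folklore] -/
theorem meets_add_abstainer_iff (θ : ℚ) (k n : ℕ) :
    (pool (Tally.mk k n) (Tally.mk 0 1)).meets θ = true ↔ θ * ((n : ℚ) + 1) ≤ (k : ℚ) := by
  simp only [pool, meets, Nat.add_zero, Nat.cast_add, Nat.cast_one, decide_eq_true_eq]

end Tally

end CellScore

end Summit.Ventures.CertifiedManyBodySolver.Downfold
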